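import Summits.Ventures.YMGap.RobustBall.BoundaryDecayBox
import Summits.Ventures.YMGap.RobustBall.LatticeSumL1
import Mathlib.Algebra.Order.Chebyshev
import HarnessLib

/-!
# Venture YMGap, track ROBUST-BALL — GAUSSIAN CONCENTRATION, step 4a: the explicit variance proxies (lattice sums)

HONEST FRAMING. WHAT THIS IS: a venture file (cell `pub-ymgap`, track Y2 ROBUST-BALL, seat ds-3, theorems only),
elementary lattice sums. The concentration theorems of `ConcentrationKR.lean` / `ConcentrationKRFamily.lean` carry an
abstract variance proxy `V ≥ Σ_{y ∈ box} c(y)²` built from the single-link influences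
`c_F(y) = 2√N K Σ_{z ∈ Δ} ρ^{⌊‖z − y‖_∞/R₀⌋₊}` (`R₀ = max(1,R)`). Here the proxies are made EXPLICIT (the `ℓ¹`-geometric
sum of `LatticeSumL1.lean`, after `‖v‖_∞ ≥ ℓ¹(v)/d` (as in ds-1's `PlaquetteSusceptibility.lean`) and `ρ ≤ ρ₊ := max(ρ,½)`): with
`Θ₂ := ((1 + r₂)/(1 − r₂))^d`, `r₂ := exp(2 log ρ₊ /(d R₀))` and `Θ₁ := ((1 + r₁)/(1 − r₁))^d`, `r₁ := exp(log ρ₊ /(d R₀))`,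

* ONE local observable: `Σ_{y ∈ boxLinks d n} c_F(y)² ≤ 16 N K² d #Δ² Θ₂` for every box (`sum_boxLinks_influence_sq_le`);
* TRANSLATE SUMS: for the translates of one Lipschitz cylinder (constant `K`, links `Δ`) by ANY finite set `B` of sites,
  `Σ_{y ∈ boxLinks d n} (Σ_{x ∈ B} c_{f∘θ_x}(y))² ≤ (16 N K² d #Δ² Θ₁²) · #B` — LINEAR in the number of terms
  (`sum_boxLinks_influence_translates_sq_le`, a Schur bound: the sum over translations is bounded uniformly in `y`,
  the box sum uniformly in the translate).

WHAT THIS IS NOT: optimal constants (the `ℓ¹` comparison loses the factor `Θ`); no measure appears in this file;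
nothing about the continuum limit or the Clay Millennium problem.

References: folklore (geometric series); the tree's `LatticeSumL1.lean` (rb-p1), `BoundaryDecay.lean`
(`pow_natFloor_le_exp_mul_exp`), Mathlib `sq_sum_le_card_mul_sum_sq`.
-/

noncomputable section

open Filter Function Real
open scoped NNReal Topology
open Literature.Probability.LatticeModels
open Literature.MathematicalPhysics.QuantumLattice
open Literature.MathematicalPhysics.QuantumFieldTheory hiding ZdEdge

namespace Summit.Ventures.YMGap.RobustBall

variable {d N : ℕ}

/-! ### Elementary lattice sums -/

/-- The ratios `r = exp(a log ρ₊ /(d R₀))` (`a > 0`, `ρ₊ = max(ρ,½)`, `ρ < 1`) lie in `[0, 1)`. [folklore] -/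
theorem exp_mul_log_div_lt_one (hd : 1 ≤ d) {ρ R₀ a : ℝ} (hρ1 : ρ < 1) (hR₀ : 0 < R₀) (ha : 0 < a) :
    0 ≤ exp (a * Real.log (max ρ (1 / 2)) / (d * R₀)) ∧ exp (a * Real.log (max ρ (1 / 2)) / (d * R₀)) < 1 := by
  refine ⟨(exp_pos _).le, ?_⟩
  rw [exp_lt_one_iff]
  have hρp0 : 0 < max ρ (1 / 2) := lt_max_of_lt_right (by norm_num)
  have hρp1 : max ρ (1 / 2) < 1 := max_lt hρ1 (by norm_num)
  have hlog : Real.log (max ρ (1 / 2)) < 0 := Real.log_neg hρp0 hρp1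
  have hdpos : (0 : ℝ) < d := by exact_mod_cast hd
  exact div_neg_of_neg_of_pos (mul_neg_of_pos_of_neg ha hlog) (mul_pos hdpos hR₀)

/-- **The geometric profile against the `ℓ¹` profile, squared**: for `0 ≤ ρ < 1`, `ρ₊ = max(ρ,½)`, `R₀ > 0`, `d ≥ 1`,
`r₂ = exp(2 log ρ₊ / (d R₀))`: `(ρ^{⌊‖v‖/R₀⌋₊})² ≤ 4 · r₂^{ℓ¹(v)}` (`⌊a⌋₊ ≥ a − 1`, `‖v‖ ≥ ℓ¹(v)/d`, `ρ₊^{-2} ≤ 4`).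
[folklore] -/
theorem pow_natFloor_sq_le_mul_pow_l1 (hd : 1 ≤ d) {ρ R₀ : ℝ} (hρ0 : 0 ≤ ρ) (hρ1 : ρ < 1) (hR₀ : 0 < R₀)
    (v : Site d) :
    (ρ ^ ⌊‖v‖ / R₀⌋₊) ^ 2 ≤ 4 * exp (2 * Real.log (max ρ (1 / 2)) / (d * R₀)) ^ l1 v := by
  set ρp : ℝ := max ρ (1 / 2) with hρp
  have hρp0 : 0 < ρp := lt_max_of_lt_right (by norm_num)
  have hρp1 : ρp < 1 := max_lt hρ1 (by norm_num)
  have hρle : ρ ≤ ρp := le_max_left _ _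
  have hhalf : (1 / 2 : ℝ) ≤ ρp := le_max_right _ _
  have hdpos : (0 : ℝ) < d := by exact_mod_cast hd
  have hlog : Real.log ρp ≤ 0 := Real.log_nonpos hρp0.le hρp1.le
  -- `ρ^k ≤ ρ₊^k`, and `(ρ₊^k)^2 = (ρ₊^2)^k`
  have h1 : (ρ ^ ⌊‖v‖ / R₀⌋₊) ^ 2 ≤ (ρp ^ 2) ^ ⌊‖v‖ / R₀⌋₊ :=
    calc (ρ ^ ⌊‖v‖ / R₀⌋₊) ^ 2 ≤ (ρp ^ ⌊‖v‖ / R₀⌋₊) ^ 2 :=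
          pow_le_pow_left₀ (pow_nonneg hρ0 _) (pow_le_pow_left₀ hρ0 hρle _) 2
      _ = (ρp ^ 2) ^ ⌊‖v‖ / R₀⌋₊ := by rw [← pow_mul, ← pow_mul, mul_comm]
  -- geometric to exponential with `c = ρ₊²`
  have hc0 : 0 < ρp ^ 2 := by positivity
  have hc1 : ρp ^ 2 ≤ 1 := pow_le_one₀ hρp0.le hρp1.le
  have h2 := pow_natFloor_le_exp_mul_exp hc0 hc1 (‖v‖ / R₀)
  -- `e^{−log(ρ₊²)} = ρ₊^{-2} ≤ 4`
  have h3 : exp (-Real.log (ρp ^ 2)) ≤ 4 := by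
    rw [Real.exp_neg, Real.exp_log hc0]
    have hq : (1 / 2 : ℝ) ^ 2 ≤ ρp ^ 2 := pow_le_pow_left₀ (by norm_num) hhalf 2
    rw [inv_le_comm₀ hc0 (by norm_num : (0 : ℝ) < 4)]
    linarith
  -- the exponential factor against the `ℓ¹` profile
  have h4 : exp (-(-Real.log (ρp ^ 2)) * (‖v‖ / R₀)) ≤ exp (2 * Real.log ρp / (d * R₀)) ^ l1 v := by
    rw [← Real.exp_nat_mul, exp_le_exp, Real.log_pow, Nat.cast_ofNat, neg_neg]
    have hl1 : (l1 v : ℝ) ≤ d * ‖v‖ := by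
      -- (`‖v‖₁ ≤ d ‖v‖_∞`; the tree's `PlaquetteSusceptibility.l1_le_mul_norm`, inlined to keep the imports light)
      unfold l1
      push_cast
      calc ∑ k, (((v k).natAbs : ℕ) : ℝ) ≤ ∑ _k : Fin d, ‖v‖ := Finset.sum_le_sum fun k _ => by
            rw [Nat.cast_natAbs, Int.cast_abs, ← Int.norm_eq_abs]
            exact norm_le_pi_norm v k
        _ = d * ‖v‖ := by rw [Finset.sum_const, Finset.card_univ, Fintype.card_fin, nsmul_eq_mul]
    have key : (l1 v : ℝ) / d ≤ ‖v‖ := by rw [div_le_iff₀ hdpos]; linarith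
    have hdiv : (l1 v : ℝ) / d / R₀ ≤ ‖v‖ / R₀ := div_le_div_of_nonneg_right key hR₀.le
    have e : (l1 v : ℝ) * (2 * Real.log ρp / (d * R₀)) = 2 * Real.log ρp * ((l1 v : ℝ) / d / R₀) := by
      field_simp
    rw [e]
    nlinarith
  calc (ρ ^ ⌊‖v‖ / R₀⌋₊) ^ 2 ≤ (ρp ^ 2) ^ ⌊‖v‖ / R₀⌋₊ := h1
    _ ≤ exp (-Real.log (ρp ^ 2)) * exp (-(-Real.log (ρp ^ 2)) * (‖v‖ / R₀)) := h2
    _ ≤ 4 * exp (2 * Real.log ρp / (d * R₀)) ^ l1 v :=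
        mul_le_mul h3 h4 (exp_pos _).le (by norm_num)

/-- **The geometric profile against the `ℓ¹` profile**: `ρ^{⌊‖v‖/R₀⌋₊} ≤ 2 · r₁^{ℓ¹(v)}`, `r₁ = exp(log ρ₊ /(d R₀))`.
[folklore] -/
theorem pow_natFloor_le_mul_pow_l1 (hd : 1 ≤ d) {ρ R₀ : ℝ} (hρ0 : 0 ≤ ρ) (hρ1 : ρ < 1) (hR₀ : 0 < R₀)
    (v : Site d) :
    ρ ^ ⌊‖v‖ / R₀⌋₊ ≤ 2 * exp (Real.log (max ρ (1 / 2)) / (d * R₀)) ^ l1 v := by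
  set ρp : ℝ := max ρ (1 / 2) with hρp
  have hρp0 : 0 < ρp := lt_max_of_lt_right (by norm_num)
  have hρp1 : ρp < 1 := max_lt hρ1 (by norm_num)
  have hρle : ρ ≤ ρp := le_max_left _ _
  have hhalf : (1 / 2 : ℝ) ≤ ρp := le_max_right _ _
  have hdpos : (0 : ℝ) < d := by exact_mod_cast hd
  have hlog : Real.log ρp ≤ 0 := Real.log_nonpos hρp0.le hρp1.le
  have h1 : ρ ^ ⌊‖v‖ / R₀⌋₊ ≤ ρp ^ ⌊‖v‖ / R₀⌋₊ := pow_le_pow_left₀ hρ0 hρle _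
  have h2 := pow_natFloor_le_exp_mul_exp hρp0 hρp1.le (‖v‖ / R₀)
  have h3 : exp (-Real.log ρp) ≤ 2 := by
    rw [Real.exp_neg, Real.exp_log hρp0, inv_le_comm₀ hρp0 (by norm_num : (0 : ℝ) < 2)]
    linarith
  have h4 : exp (-(-Real.log ρp) * (‖v‖ / R₀)) ≤ exp (Real.log ρp / (d * R₀)) ^ l1 v := by
    rw [← Real.exp_nat_mul, exp_le_exp, neg_neg]
    have hl1 : (l1 v : ℝ) ≤ d * ‖v‖ := by
      -- (`‖v‖₁ ≤ d ‖v‖_∞`; the tree's `PlaquetteSusceptibility.l1_le_mul_norm`, inlined to keep the imports light)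
      unfold l1
      push_cast
      calc ∑ k, (((v k).natAbs : ℕ) : ℝ) ≤ ∑ _k : Fin d, ‖v‖ := Finset.sum_le_sum fun k _ => by
            rw [Nat.cast_natAbs, Int.cast_abs, ← Int.norm_eq_abs]
            exact norm_le_pi_norm v k
        _ = d * ‖v‖ := by rw [Finset.sum_const, Finset.card_univ, Fintype.card_fin, nsmul_eq_mul]
    have key : (l1 v : ℝ) / d ≤ ‖v‖ := by rw [div_le_iff₀ hdpos]; linarith
    have hdiv : (l1 v : ℝ) / d / R₀ ≤ ‖v‖ / R₀ := div_le_div_of_nonneg_right key hR₀.le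
    have e : (l1 v : ℝ) * (Real.log ρp / (d * R₀)) = Real.log ρp * ((l1 v : ℝ) / d / R₀) := by
      field_simp
    rw [e]
    nlinarith
  calc ρ ^ ⌊‖v‖ / R₀⌋₊ ≤ ρp ^ ⌊‖v‖ / R₀⌋₊ := h1
    _ ≤ exp (-Real.log ρp) * exp (-(-Real.log ρp) * (‖v‖ / R₀)) := h2
    _ ≤ 2 * exp (Real.log ρp / (d * R₀)) ^ l1 v := mul_le_mul h3 h4 (exp_pos _).le (by norm_num)

/-- **Box sum of the squared profile around a link**: for every link `z` and every box,
`Σ_{y ∈ boxLinks d n} (ρ^{⌊‖z − y‖/R₀⌋₊})² ≤ 4 d · ((1 + r₂)/(1 − r₂))^d`. [folklore] -/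
theorem sum_boxLinks_pow_natFloor_sq_le (hd : 1 ≤ d) {ρ R₀ : ℝ} (hρ0 : 0 ≤ ρ) (hρ1 : ρ < 1) (hR₀ : 0 < R₀)
    (z : ZdEdge d) (n : ℕ) :
    ∑ y ∈ boxLinks d n, (ρ ^ ⌊‖z.1 - y.1‖ / R₀⌋₊) ^ 2 ≤
      4 * d * ((1 + exp (2 * Real.log (max ρ (1 / 2)) / (d * R₀))) /
        (1 - exp (2 * Real.log (max ρ (1 / 2)) / (d * R₀)))) ^ d := by
  set r : ℝ := exp (2 * Real.log (max ρ (1 / 2)) / (d * R₀)) with hr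
  obtain ⟨hr0, hr1⟩ := exp_mul_log_div_lt_one hd (a := 2) hρ1 hR₀ (by norm_num)
  rw [boxLinks, Finset.sum_product]
  calc ∑ x ∈ siteBox d n, ∑ i : Fin d, (ρ ^ ⌊‖z.1 - (x, i).1‖ / R₀⌋₊) ^ 2
      = ∑ x ∈ siteBox d n, (d : ℝ) * (ρ ^ ⌊‖z.1 - x‖ / R₀⌋₊) ^ 2 := by
        refine Finset.sum_congr rfl fun x _ => ?_
        simp only [Finset.sum_const, Finset.card_univ, Fintype.card_fin, nsmul_eq_mul]
    _ ≤ ∑ x ∈ siteBox d n, (d : ℝ) * (4 * r ^ l1 (z.1 - x)) :=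
        Finset.sum_le_sum fun x _ => mul_le_mul_of_nonneg_left
          (pow_natFloor_sq_le_mul_pow_l1 hd hρ0 hρ1 hR₀ (z.1 - x)) (Nat.cast_nonneg _)
    _ = 4 * d * ∑ x ∈ siteBox d n, r ^ l1 (z.1 - x) := by
        rw [Finset.mul_sum]
        exact Finset.sum_congr rfl fun x _ => by ring
    _ ≤ 4 * d * ((1 + r) / (1 - r)) ^ d :=
        mul_le_mul_of_nonneg_left (sum_pow_l1_sub_le hr0 hr1 z.1 (siteBox d n)) (by positivity)

/-- **Box sum of the profile around a link** (first power): `Σ_{y ∈ boxLinks d n} ρ^{⌊‖z − y‖/R₀⌋₊} ≤ 2 d · Θ₁`.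
[folklore] -/
theorem sum_boxLinks_pow_natFloor_le (hd : 1 ≤ d) {ρ R₀ : ℝ} (hρ0 : 0 ≤ ρ) (hρ1 : ρ < 1) (hR₀ : 0 < R₀)
    (z : ZdEdge d) (n : ℕ) :
    ∑ y ∈ boxLinks d n, ρ ^ ⌊‖z.1 - y.1‖ / R₀⌋₊ ≤
      2 * d * ((1 + exp (Real.log (max ρ (1 / 2)) / (d * R₀))) /
        (1 - exp (Real.log (max ρ (1 / 2)) / (d * R₀)))) ^ d := by
  set r : ℝ := exp (Real.log (max ρ (1 / 2)) / (d * R₀)) with hr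
  obtain ⟨hr0, hr1⟩ := exp_mul_log_div_lt_one hd (a := 1) hρ1 hR₀ (by norm_num)
  rw [one_mul] at hr0 hr1
  rw [boxLinks, Finset.sum_product]
  calc ∑ x ∈ siteBox d n, ∑ i : Fin d, ρ ^ ⌊‖z.1 - (x, i).1‖ / R₀⌋₊
      = ∑ x ∈ siteBox d n, (d : ℝ) * ρ ^ ⌊‖z.1 - x‖ / R₀⌋₊ := by
        refine Finset.sum_congr rfl fun x _ => ?_
        simp only [Finset.sum_const, Finset.card_univ, Fintype.card_fin, nsmul_eq_mul]
    _ ≤ ∑ x ∈ siteBox d n, (d : ℝ) * (2 * r ^ l1 (z.1 - x)) :=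
        Finset.sum_le_sum fun x _ => mul_le_mul_of_nonneg_left
          (pow_natFloor_le_mul_pow_l1 hd hρ0 hρ1 hR₀ (z.1 - x)) (Nat.cast_nonneg _)
    _ = 2 * d * ∑ x ∈ siteBox d n, r ^ l1 (z.1 - x) := by
        rw [Finset.mul_sum]
        exact Finset.sum_congr rfl fun x _ => by ring
    _ ≤ 2 * d * ((1 + r) / (1 - r)) ^ d :=
        mul_le_mul_of_nonneg_left (sum_pow_l1_sub_le hr0 hr1 z.1 (siteBox d n)) (by positivity)

/-- **Sum of the profile over ANY finite set of translations**: `Σ_{x ∈ B} ρ^{⌊‖w − x‖/R₀⌋₊} ≤ 2 Θ₁`. [folklore] -/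
theorem sum_translates_pow_natFloor_le (hd : 1 ≤ d) {ρ R₀ : ℝ} (hρ0 : 0 ≤ ρ) (hρ1 : ρ < 1) (hR₀ : 0 < R₀)
    (w : Site d) (B : Finset (Site d)) :
    ∑ x ∈ B, ρ ^ ⌊‖w - x‖ / R₀⌋₊ ≤
      2 * ((1 + exp (Real.log (max ρ (1 / 2)) / (d * R₀))) /
        (1 - exp (Real.log (max ρ (1 / 2)) / (d * R₀)))) ^ d := by
  set r : ℝ := exp (Real.log (max ρ (1 / 2)) / (d * R₀)) with hr
  obtain ⟨hr0, hr1⟩ := exp_mul_log_div_lt_one hd (a := 1) hρ1 hR₀ (by norm_num)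
  rw [one_mul] at hr0 hr1
  calc ∑ x ∈ B, ρ ^ ⌊‖w - x‖ / R₀⌋₊ ≤ ∑ x ∈ B, 2 * r ^ l1 (w - x) :=
        Finset.sum_le_sum fun x _ => pow_natFloor_le_mul_pow_l1 hd hρ0 hρ1 hR₀ (w - x)
    _ = 2 * ∑ x ∈ B, r ^ l1 (w - x) := by rw [Finset.mul_sum]
    _ ≤ 2 * ((1 + r) / (1 - r)) ^ d := mul_le_mul_of_nonneg_left (sum_pow_l1_sub_le hr0 hr1 w B) (by norm_num)

/-! ### Explicit proxy for one local observable -/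

/-- **EXPLICIT VARIANCE PROXY FOR ONE LIPSCHITZ CYLINDER**: for `0 ≤ ρ < 1`, range `R` (`R₀ = max(1,R)`), `d ≥ 1` and
every box, `Σ_{y ∈ boxLinks d n} (2√N K Σ_{z ∈ Δ} ρ^{⌊‖z − y‖/R₀⌋₊})² ≤ 16 N K² d #Δ² Θ₂`,
`Θ₂ = ((1 + r₂)/(1 − r₂))^d`, `r₂ = exp(2 log max(ρ,½) / (d R₀))` (Cauchy–Schwarz in `z`, then the box sum).
[folklore] -/
theorem sum_boxLinks_influence_sq_le (hd : 1 ≤ d) {ρ R : ℝ} (hρ0 : 0 ≤ ρ) (hρ1 : ρ < 1) (K : ℝ≥0)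
    (Δ : Finset (ZdEdge d)) (n : ℕ) :
    ∑ y ∈ boxLinks d n, (2 * Real.sqrt N * K * ∑ z ∈ Δ, ρ ^ ⌊‖z.1 - y.1‖ / max 1 R⌋₊) ^ 2 ≤
      16 * N * (K : ℝ) ^ 2 * d * (Δ.card : ℝ) ^ 2 *
        ((1 + exp (2 * Real.log (max ρ (1 / 2)) / (d * max 1 R))) /
          (1 - exp (2 * Real.log (max ρ (1 / 2)) / (d * max 1 R)))) ^ d := by
  have hR₀ : 0 < max 1 R := zero_lt_one.trans_le (le_max_left _ _)
  set Θ : ℝ := ((1 + exp (2 * Real.log (max ρ (1 / 2)) / (d * max 1 R))) /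
    (1 - exp (2 * Real.log (max ρ (1 / 2)) / (d * max 1 R)))) ^ d with hΘ
  have hK : (0 : ℝ) ≤ K := K.2
  have hsqrt : Real.sqrt N ^ 2 = N := Real.sq_sqrt (Nat.cast_nonneg N)
  -- Cauchy–Schwarz in `z`
  have hCS : ∀ y : ZdEdge d, (∑ z ∈ Δ, ρ ^ ⌊‖z.1 - y.1‖ / max 1 R⌋₊) ^ 2 ≤
      Δ.card * ∑ z ∈ Δ, (ρ ^ ⌊‖z.1 - y.1‖ / max 1 R⌋₊) ^ 2 := fun y => sq_sum_le_card_mul_sum_sq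
  calc ∑ y ∈ boxLinks d n, (2 * Real.sqrt N * K * ∑ z ∈ Δ, ρ ^ ⌊‖z.1 - y.1‖ / max 1 R⌋₊) ^ 2
      = (2 * Real.sqrt N * K) ^ 2 * ∑ y ∈ boxLinks d n, (∑ z ∈ Δ, ρ ^ ⌊‖z.1 - y.1‖ / max 1 R⌋₊) ^ 2 := by
        rw [Finset.mul_sum]
        exact Finset.sum_congr rfl fun y _ => by ring
    _ ≤ (2 * Real.sqrt N * K) ^ 2 *
          ∑ y ∈ boxLinks d n, ((Δ.card : ℝ) * ∑ z ∈ Δ, (ρ ^ ⌊‖z.1 - y.1‖ / max 1 R⌋₊) ^ 2) :=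
        mul_le_mul_of_nonneg_left (Finset.sum_le_sum fun y _ => hCS y) (sq_nonneg _)
    _ = (2 * Real.sqrt N * K) ^ 2 * ((Δ.card : ℝ) *
          ∑ z ∈ Δ, ∑ y ∈ boxLinks d n, (ρ ^ ⌊‖z.1 - y.1‖ / max 1 R⌋₊) ^ 2) := by
        rw [← Finset.mul_sum, Finset.sum_comm]
    _ ≤ (2 * Real.sqrt N * K) ^ 2 * ((Δ.card : ℝ) * ∑ _z ∈ Δ, 4 * (d : ℝ) * Θ) := by
        refine mul_le_mul_of_nonneg_left (mul_le_mul_of_nonneg_left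
          (Finset.sum_le_sum fun z _ => ?_) (Nat.cast_nonneg _)) (sq_nonneg _)
        exact sum_boxLinks_pow_natFloor_sq_le hd hρ0 hρ1 hR₀ z n
    _ = 16 * N * (K : ℝ) ^ 2 * d * (Δ.card : ℝ) ^ 2 * Θ := by
        rw [Finset.sum_const, nsmul_eq_mul, mul_pow, mul_pow, hsqrt]
        ring

/-! ### Translate sums: the proxy is linear in the number of terms -/

/-- **EXPLICIT PROXY FOR TRANSLATE SUMS, LINEAR IN THE NUMBER OF TERMS** (Schur bound): for a Lipschitz cylinder of
constant `K` on `Δ`, its translates by the sites `x ∈ B` (supports `{(e − x, i)}`), `0 ≤ ρ < 1`, `d ≥ 1`: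
`Σ_{y ∈ boxLinks d n} (Σ_{x ∈ B} 2√N K Σ_{z ∈ Δ − x} ρ^{⌊‖z − y‖/R₀⌋₊})² ≤ (16 N K² d #Δ² Θ₁²) · #B`,
`Θ₁ = ((1 + r₁)/(1 − r₁))^d`, `r₁ = exp(log max(ρ,½)/(d R₀))` — `(Σ_x a_x)² ≤ (sup_y Σ_x a_x(y)) Σ_x a_x(y)` with
`Σ_x a_x(y) ≤ 2√N K #Δ · 2Θ₁` uniformly in `y` (sum over translations) and `Σ_y a_x(y) ≤ 2√N K #Δ · 2dΘ₁` (box sum).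
[folklore] -/
theorem sum_boxLinks_influence_translates_sq_le (hd : 1 ≤ d) {ρ R : ℝ} (hρ0 : 0 ≤ ρ) (hρ1 : ρ < 1) (K : ℝ≥0)
    (Δ : Finset (ZdEdge d)) (B : Finset (Site d)) (n : ℕ) :
    ∑ y ∈ boxLinks d n, (∑ x ∈ B, 2 * Real.sqrt N * K *
        ∑ z ∈ Δ.image (fun e : ZdEdge d => (e.1 - x, e.2)), ρ ^ ⌊‖z.1 - y.1‖ / max 1 R⌋₊) ^ 2 ≤
      16 * N * (K : ℝ) ^ 2 * d * (Δ.card : ℝ) ^ 2 *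
        (((1 + exp (Real.log (max ρ (1 / 2)) / (d * max 1 R))) /
          (1 - exp (Real.log (max ρ (1 / 2)) / (d * max 1 R)))) ^ d) ^ 2 * B.card := by
  classical
  have hR₀ : 0 < max 1 R := zero_lt_one.trans_le (le_max_left _ _)
  set Θ : ℝ := ((1 + exp (Real.log (max ρ (1 / 2)) / (d * max 1 R))) /
    (1 - exp (Real.log (max ρ (1 / 2)) / (d * max 1 R)))) ^ d with hΘ
  have hK : (0 : ℝ) ≤ K := K.2
  obtain ⟨hr0, hr1⟩ := exp_mul_log_div_lt_one hd (a := 1) (R₀ := max 1 R) hρ1 hR₀ (by norm_num)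
  rw [one_mul] at hr0 hr1
  have hΘ0 : 0 ≤ Θ := pow_nonneg (div_nonneg (by linarith) (by linarith)) _
  -- the summands `a x y`
  set a : Site d → ZdEdge d → ℝ := fun x y => 2 * Real.sqrt N * K *
    ∑ z ∈ Δ.image (fun e : ZdEdge d => (e.1 - x, e.2)), ρ ^ ⌊‖z.1 - y.1‖ / max 1 R⌋₊ with ha
  have ha0 : ∀ (x : Site d) (y : ZdEdge d), 0 ≤ a x y := fun x y =>
    mul_nonneg (by positivity) (Finset.sum_nonneg fun z _ => pow_nonneg hρ0 _)
  -- the image sum is dominated by the sum over `Δ` of the translated profile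
  have himg : ∀ (x : Site d) (y : ZdEdge d),
      ∑ z ∈ Δ.image (fun e : ZdEdge d => (e.1 - x, e.2)), ρ ^ ⌊‖z.1 - y.1‖ / max 1 R⌋₊ ≤
        ∑ e ∈ Δ, ρ ^ ⌊‖(e.1 - y.1) - x‖ / max 1 R⌋₊ := fun x y => by
    refine (Finset.sum_image_le_of_nonneg fun e _ => pow_nonneg hρ0 _).trans (le_of_eq ?_)
    refine Finset.sum_congr rfl fun e _ => ?_
    rw [show (e.1 - x) - y.1 = (e.1 - y.1) - x by abel]
  -- uniform bound of the sum over translations: `Σ_x a x y ≤ 2√N K (#Δ 2Θ)`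
  have hA : ∀ y : ZdEdge d, ∑ x ∈ B, a x y ≤ 2 * Real.sqrt N * K * (Δ.card * (2 * Θ)) := fun y => by
    simp only [ha]
    rw [← Finset.mul_sum]
    refine mul_le_mul_of_nonneg_left ?_ (by positivity)
    calc ∑ x ∈ B, ∑ z ∈ Δ.image (fun e : ZdEdge d => (e.1 - x, e.2)), ρ ^ ⌊‖z.1 - y.1‖ / max 1 R⌋₊
        ≤ ∑ x ∈ B, ∑ e ∈ Δ, ρ ^ ⌊‖(e.1 - y.1) - x‖ / max 1 R⌋₊ := Finset.sum_le_sum fun x _ => himg x y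
      _ = ∑ e ∈ Δ, ∑ x ∈ B, ρ ^ ⌊‖(e.1 - y.1) - x‖ / max 1 R⌋₊ := Finset.sum_comm
      _ ≤ ∑ _e ∈ Δ, 2 * Θ := Finset.sum_le_sum fun e _ =>
          sum_translates_pow_natFloor_le hd hρ0 hρ1 hR₀ (e.1 - y.1) B
      _ = Δ.card * (2 * Θ) := by rw [Finset.sum_const, nsmul_eq_mul]
  -- box sum for each translate: `Σ_y a x y ≤ 2√N K (#Δ 2dΘ)`
  have hBsum : ∀ x : Site d, ∑ y ∈ boxLinks d n, a x y ≤ 2 * Real.sqrt N * K * (Δ.card * (2 * d * Θ)) :=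
    fun x => by
    simp only [ha]
    rw [← Finset.mul_sum]
    refine mul_le_mul_of_nonneg_left ?_ (by positivity)
    calc ∑ y ∈ boxLinks d n, ∑ z ∈ Δ.image (fun e : ZdEdge d => (e.1 - x, e.2)), ρ ^ ⌊‖z.1 - y.1‖ / max 1 R⌋₊
        ≤ ∑ y ∈ boxLinks d n, ∑ e ∈ Δ, ρ ^ ⌊‖(e.1 - y.1) - x‖ / max 1 R⌋₊ :=
          Finset.sum_le_sum fun y _ => himg x y
      _ = ∑ e ∈ Δ, ∑ y ∈ boxLinks d n, ρ ^ ⌊‖((e.1 - x, e.2) : ZdEdge d).1 - y.1‖ / max 1 R⌋₊ := by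
          rw [Finset.sum_comm]
          refine Finset.sum_congr rfl fun e _ => Finset.sum_congr rfl fun y _ => ?_
          rw [show (e.1 - y.1) - x = (e.1 - x) - y.1 by abel]
      _ ≤ ∑ _e ∈ Δ, 2 * (d : ℝ) * Θ := Finset.sum_le_sum fun e _ =>
          sum_boxLinks_pow_natFloor_le hd hρ0 hρ1 hR₀ ((e.1 - x, e.2) : ZdEdge d) n
      _ = Δ.card * (2 * d * Θ) := by rw [Finset.sum_const, nsmul_eq_mul]
  -- Schur: `Σ_y (Σ_x a)² ≤ A · Σ_x Σ_y a ≤ A · #B · B₁`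
  have hsqrt : Real.sqrt N * Real.sqrt N = N := Real.mul_self_sqrt (Nat.cast_nonneg N)
  calc ∑ y ∈ boxLinks d n, (∑ x ∈ B, a x y) ^ 2
      ≤ ∑ y ∈ boxLinks d n, (2 * Real.sqrt N * K * (Δ.card * (2 * Θ))) * ∑ x ∈ B, a x y := by
        refine Finset.sum_le_sum fun y _ => ?_
        rw [sq]
        exact mul_le_mul_of_nonneg_right (hA y) (Finset.sum_nonneg fun x _ => ha0 x y)
    _ = (2 * Real.sqrt N * K * (Δ.card * (2 * Θ))) * ∑ x ∈ B, ∑ y ∈ boxLinks d n, a x y := by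
        rw [← Finset.mul_sum, Finset.sum_comm]
    _ ≤ (2 * Real.sqrt N * K * (Δ.card * (2 * Θ))) * ∑ _x ∈ B, 2 * Real.sqrt N * K * (Δ.card * (2 * d * Θ)) :=
        mul_le_mul_of_nonneg_left (Finset.sum_le_sum fun x _ => hBsum x) (by positivity)
    _ = 16 * (Real.sqrt N * Real.sqrt N) * (K : ℝ) ^ 2 * d * (Δ.card : ℝ) ^ 2 * Θ ^ 2 * B.card := by
        rw [Finset.sum_const, nsmul_eq_mul]
        ring
    _ = 16 * N * (K : ℝ) ^ 2 * d * (Δ.card : ℝ) ^ 2 * Θ ^ 2 * B.card := by rw [hsqrt]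

end Summit.Ventures.YMGap.RobustBall

end
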